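import Summits.NavierStokesRegularity.NavierStokesRegularity.Theorems.ApexLocalisation.Negative.BridgeBlowDown
import Literature.Analysis.FluidPDE.KNSSTypeIRateMildProofs
import Literature.Analysis.FluidPDE.OseenDuhamelLimits
import Literature.Analysis.FluidPDE.KNSSRegularityGalileanProofs

/-!
# `ApexLocalisation` (crux stmt-NavierStokesRegularity-11719): the PICKED line `decaying-ancient-bridge`
# — the hull closure `stub_hullClosed` modulo the engine — negative-side support (drefute seat, gen 3)

Companion of `Negative/BridgeTargets.lean`, `Negative/BridgeVacuity.lean` (and `Negative/BridgeBlowDown.lean`,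
p74933) for the lead's skeleton `Cruxes/ApexLocalisation/Lines/decaying-ancient-bridge.lean` (sha `adc980f7…`).
No new definitions. Main result:

* `inBridgeClass_hullLimit` — granted the engine statement `SlabEngine` (`stub_slabCompactness` verbatim), a slice-wise locally uniform limit `N` (continuous on the open slab) of admissible hull images
  `λ_k M(t_k + λ_k² ·, x_k + λ_k ·)` (`t_k ≤ 0`, `0 < λ_k ≤ 1`) of a member `M` of the line's class 𝒜(C,B)
  (`InBridgeClass`) is again a member of 𝒜(C,B). The closing `example` has the VERBATIM type of the lead's
  `stub_hullClosed` — so that stub holds outright (candidate proof for the lead).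

Ingredients (all in tree): kinematics of hull images (`norm_hull_le`, `hasTypeITimeDecay_hull`,
`IsWeaklyDivFree.comp_add_right'` + `IsWeaklyDivFree.nsRescaleData`, Oseen covariance `oseen_smul_stPull`);
limit passage (`tendsto_heatExtension_of_tendsto_of_bound`, `tendsto_oseenDuhamel_of_tendsto_of_bound`, dominated
convergence for `∫⟪V_k(t), ∇θ⟫ = 0`); suitable data with `𝐈 < ⊤` for the limit from the ENGINE run on the
transformed suitable triples (`zoom_isSuitableWeakSolutionOn` + `IsSuitableWeakSolutionOn.of_le`,
`zoom_hasWeakSpatialGradientOn`, `abScaledSum_zoom_le_typeIBound`) and the identification `u' = N` a.e. on the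
slab (a.e.-convergent subsequences of the `L³(Q(0,n+1))`-convergent ones, uniqueness of limits), then
`IsSuitableWeakSolutionOn.congr_ae`, `HasWeakSpatialGradientOn.congr_ae`, `typeIBound_congr_ae`
(KNSS 2009 Lemma 6.1-type compactness bookkeeping; Albritton–Barker 2019 Lemma 2.2 / Prop. 2.3 via the engine).

## References

* G. Koch, N. Nadirashvili, G. Seregin, V. Šverák, Acta Math. 203 (2009), Lemma 4.1, Lemma 6.1, §6. [KNSS2009]
* D. Albritton, T. Barker, J. Math. Fluid Mech. 21 (2019) = arXiv:1811.00502, Lemma 2.2, Prop. 2.3. [AlbrittonBarker2019]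
-/

set_option linter.dupNamespace false

noncomputable section

open MeasureTheory TopologicalSpace Set Function Filter Topology Metric
open scoped InnerProductSpace RealInnerProductSpace ENNReal NNReal
open Literature.Analysis Literature.Analysis.FluidPDE Literature.Analysis.FunctionSpaces
open Summit.NavierStokesRegularity.NavierStokesRegularity.Theses

namespace Summit.NavierStokesRegularity.NavierStokesRegularity.Theorems.ApexLocalisation.Negative

/-- Physical space (the skeleton writes `E³`). -/
local notation "E³" => EuclideanSpace ℝ (Fin 3)

/-! ## §1 Kinematics of admissible hull images -/

/-- A hull image is continuous on the open slab (`t_k ≤ 0` keeps the image times negative). -/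
theorem continuousOn_hullImage {M : ℝ → E³ → E³} (hcont : ContinuousOn (uncurry M) (Iio (0 : ℝ) ×ˢ univ))
    {x₀ : E³} {t₀ lam : ℝ} (ht₀ : t₀ ≤ 0) (hl0 : 0 < lam) :
    ContinuousOn (uncurry (lam • stPull (lam ^ 2) lam t₀ x₀ M)) (Iio (0 : ℝ) ×ˢ univ) := by
  have e : uncurry (lam • stPull (lam ^ 2) lam t₀ x₀ M) =
      fun w => lam • uncurry M (stAffine (lam ^ 2) lam t₀ x₀ w) := by
    funext w; rfl
  rw [e]
  refine ContinuousOn.const_smul (hcont.comp (continuous_stAffine _ _ _ _).continuousOn ?_) lam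
  rintro ⟨t, y⟩ ⟨ht, -⟩
  simp only [mem_Iio] at ht
  refine ⟨?_, mem_univ _⟩
  show t₀ + lam ^ 2 * t < 0
  nlinarith [mul_neg_of_pos_of_neg (pow_pos hl0 2) ht]

/-- Slices of hull images of a field with weakly divergence-free slices are weakly divergence free
(translation covariance `IsWeaklyDivFree.comp_add_right'` and scaling covariance
`IsWeaklyDivFree.nsRescaleData`). -/
theorem isWeaklyDivFree_hullImage {M : ℝ → E³ → E³} (hdiv : ∀ t < 0, IsWeaklyDivFree (M t))
    {x₀ : E³} {t₀ lam : ℝ} (ht₀ : t₀ ≤ 0) (hl0 : 0 < lam) {t : ℝ} (ht : t < 0) :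
    IsWeaklyDivFree ((lam • stPull (lam ^ 2) lam t₀ x₀ M) t) := by
  have htime : t₀ + lam ^ 2 * t < 0 := by nlinarith [mul_neg_of_pos_of_neg (pow_pos hl0 2) ht]
  have h := ((hdiv _ htime).comp_add_right' x₀).nsRescaleData hl0
  have e : (lam • stPull (lam ^ 2) lam t₀ x₀ M) t =
      nsRescaleData lam (fun w => M (t₀ + lam ^ 2 * t) (w + x₀)) := by
    funext y
    simp only [Pi.smul_apply, stPull_apply, nsRescaleData, add_comm x₀]
  rwa [e]

/-- The backward slab lies in its own pull-back under an admissible hull map (`t₀ ≤ 0`). -/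
theorem slab_le_stPreimage_hull {t₀ : ℝ} (ht₀ : t₀ ≤ 0) {lam : ℝ} (hl0 : 0 < lam) (x₀ : E³) :
    (slab E³ (Iio 0) isOpen_Iio) ≤ stPreimage (lam ^ 2) lam t₀ x₀ (slab E³ (Iio 0) isOpen_Iio) := by
  intro w hw
  have hw' : w.1 < 0 := by simpa [mem_slab] using hw
  show stAffine (lam ^ 2) lam t₀ x₀ w ∈ (slab E³ (Iio 0) isOpen_Iio : Opens (ℝ × E³))
  rw [mem_slab, stAffine_fst]
  show t₀ + lam ^ 2 * w.1 < 0
  nlinarith [mul_neg_of_pos_of_neg (pow_pos hl0 2) hw']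

/-- If `Q(z, r) ⊆ (-∞,0) × ℝ³` with `r > 0` then `t ≤ 0`. -/
theorem fst_nonpos_of_parabolicCylinder_subset_slab {r : ℝ} (hr : 0 < r) {z : ℝ × E³}
    (h : parabolicCylinder r z ⊆ Iio (0 : ℝ) ×ˢ (univ : Set E³)) : z.1 ≤ 0 := by
  by_contra hz
  push Not at hz
  set ε := min (r ^ 2 / 2) (z.1 / 2) with hε
  have hε1 : ε ≤ r ^ 2 / 2 := min_le_left _ _
  have hε2 : ε ≤ z.1 / 2 := min_le_right _ _
  have hε0 : 0 < ε := lt_min (by positivity) (by linarith)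
  have hw : (z.1 - ε, z.2) ∈ parabolicCylinder r z := by
    rw [mem_parabolicCylinder]
    exact ⟨⟨by dsimp only; nlinarith [sq_nonneg r], by dsimp only; linarith⟩, by simpa using hr⟩
  have hw' := h hw
  have : z.1 - ε < 0 := hw'.1
  linarith

/-! ## §2 Limits of fields with divergence-free slices -/

/-- **Every slice of a pointwise limit of uniformly bounded continuous slab fields with weakly
divergence-free slices is weakly divergence free** (dominated convergence in `∫ ⟪V_k(t), ∇θ⟫ = 0`). -/
theorem isWeaklyDivFree_of_tendsto_slab {B : ℝ} {V : ℕ → ℝ → E³ → E³} {v : ℝ → E³ → E³}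
    (hdiv : ∀ k, ∀ t < 0, IsWeaklyDivFree (V k t))
    (hcont : ∀ k, ContinuousOn (uncurry (V k)) (Iio (0 : ℝ) ×ˢ univ))
    (hbd : ∀ k, ∀ t < 0, ∀ x, ‖V k t x‖ ≤ B)
    (hlim : ∀ t < 0, ∀ x, Tendsto (fun k => V k t x) atTop (𝓝 (v t x))) :
    ∀ t < 0, IsWeaklyDivFree (v t) := by
  intro t ht0 θ hθ
  have hθ1 : ContDiff ℝ 1 θ := contDiff_infty.1 hθ.contDiff 1
  have hgc : HasCompactSupport (gradient θ) := by
    have : gradient θ = (fun L => (InnerProductSpace.toDual ℝ E³).symm L) ∘ fderiv ℝ θ := rfl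
    rw [this]
    exact (hθ.hasCompactSupport.fderiv (𝕜 := ℝ)).comp_left (by simp)
  have hθi : Integrable (fun x => B * ‖gradient θ x‖) volume :=
    (((continuous_gradient_of_contDiff hθ1).integrable_of_hasCompactSupport hgc).norm).const_mul B
  have hlimθ : Tendsto (fun k => ∫ x, ⟪V k t x, gradient θ x⟫) atTop
      (𝓝 (∫ x, ⟪v t x, gradient θ x⟫)) := by
    refine tendsto_integral_filter_of_dominated_convergence (fun x => B * ‖gradient θ x‖)
      ?_ ?_ hθi (Eventually.of_forall fun x => (hlim t ht0 x).inner tendsto_const_nhds)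
    · refine Eventually.of_forall fun k => ?_
      have hsl : Continuous (V k t) :=
        ((hcont k).comp_continuous (Continuous.prodMk_right t) fun x => ⟨ht0, mem_univ x⟩)
      exact (hsl.inner (continuous_gradient_of_contDiff hθ1)).aestronglyMeasurable
    · refine Eventually.of_forall fun k => Eventually.of_forall fun x => ?_
      exact (norm_inner_le_norm _ _).trans (mul_le_mul_of_nonneg_right (hbd k t ht0 x) (norm_nonneg _))
  have hzero : ∀ k, ∫ x, ⟪V k t x, gradient θ x⟫ = 0 := fun k => hdiv k t ht0 θ hθ
  simp_rw [hzero] at hlimθ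
  exact (tendsto_nhds_unique hlimθ tendsto_const_nhds).symm ▸ rfl

/-! ## §3 The hull closure modulo the engine -/

/-- **HULL CLOSURE MODULO THE ENGINE** (`stub_hullClosed` with its engine antecedent as a hypothesis,
stated over `InBridgeClass`; the verbatim stub is the closing `example`). -/
theorem inBridgeClass_hullLimit (hE : SlabEngine)
    {C B : ℝ} {M : ℝ → E³ → E³} {xk : ℕ → E³} {tk lk : ℕ → ℝ} {N : ℝ → E³ → E³}
    (hM : InBridgeClass C B M) (hadm : ∀ k, tk k ≤ 0 ∧ 0 < lk k ∧ lk k ≤ 1)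
    (hconv : ∀ t < 0, TendstoLocallyUniformly
      (fun k (y : E³) => lk k • M (tk k + lk k ^ 2 * t) (xk k + lk k • y)) (N t) atTop)
    (hNcont : ContinuousOn (uncurry N) (Iio (0 : ℝ) ×ˢ univ)) :
    InBridgeClass C B N := by
  obtain ⟨hcont, hdiv, hoseen, hB, hC, q, H, hsws, hgrad, hI⟩ := hM
  -- the hull images as zooms
  set V : ℕ → ℝ → E³ → E³ := fun k => lk k • stPull (lk k ^ 2) (lk k) (tk k) (xk k) M with hV
  have hB0 : 0 ≤ B := (norm_nonneg _).trans (hB (-1) (by norm_num) 0)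
  have hpt : ∀ t < 0, ∀ y : E³, Tendsto (fun k => V k t y) atTop (𝓝 (N t y)) :=
    fun t ht y => (tendstoLocallyUniformlyOn_univ.2 (hconv t ht)).tendsto_at (mem_univ y)
  have hVcont : ∀ k, ContinuousOn (uncurry (V k)) (Iio (0 : ℝ) ×ˢ univ) := fun k =>
    continuousOn_hullImage hcont (hadm k).1 (hadm k).2.1
  have hVB : ∀ k, ∀ t < 0, ∀ y : E³, ‖V k t y‖ ≤ B := fun k t ht y =>
    norm_hull_le hB (hadm k).1 (hadm k).2.1 (hadm k).2.2 t ht y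
  have hVC : ∀ k, HasTypeITimeDecay C (V k) := fun k =>
    hasTypeITimeDecay_hull hC (hadm k).1 (hadm k).2.1
  have hVdiv : ∀ k, ∀ t < 0, IsWeaklyDivFree (V k t) := fun k t ht =>
    isWeaklyDivFree_hullImage hdiv (hadm k).1 (hadm k).2.1 ht
  have hVoseen : ∀ k (s t : ℝ), s < t → t < 0 → ∀ x : E³,
      V k t x = UnboundedOperators.heatExtension (V k s) (t - s) x - oseenDuhamel 1 s (V k) (V k) t x := by
    intro k s t hst ht x
    have hl0 := (hadm k).2.1
    have h1 : tk k + lk k ^ 2 * s < tk k + lk k ^ 2 * t := by nlinarith [pow_pos hl0 2]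
    have h2 : tk k + lk k ^ 2 * t < 0 := by nlinarith [mul_neg_of_pos_of_neg (pow_pos hl0 2) ht, (hadm k).1]
    exact oseen_smul_stPull hl0 (tk k) (xk k) hst (fun X => hoseen _ _ h1 h2 X) x
  -- slices are continuous
  have hVslice : ∀ k, ∀ t < 0, Continuous (V k t) := fun k t ht =>
    (hVcont k).comp_continuous (Continuous.prodMk_right t) fun x => ⟨ht, mem_univ x⟩
  have hNslice : ∀ t < 0, Continuous (N t) := fun t ht =>
    hNcont.comp_continuous (Continuous.prodMk_right t) fun x => ⟨ht, mem_univ x⟩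
  -- (ii) divergence free
  have hNdiv : ∀ t < 0, IsWeaklyDivFree (N t) := isWeaklyDivFree_of_tendsto_slab hVdiv hVcont hVB hpt
  -- (iii) the Oseen identity passes to the limit
  have hNoseen : ∀ s t : ℝ, s < t → t < 0 → ∀ x : E³,
      N t x = UnboundedOperators.heatExtension (N s) (t - s) x - oseenDuhamel 1 s N N t x := by
    intro s t hst ht x
    have hs : s < 0 := hst.trans ht
    have h1 : Tendsto (fun k => V k t x) atTop (𝓝 (N t x)) := hpt t ht x
    have h2 : Tendsto (fun k => UnboundedOperators.heatExtension (V k s) (t - s) x) atTop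
        (𝓝 (UnboundedOperators.heatExtension (N s) (t - s) x)) :=
      tendsto_heatExtension_of_tendsto_of_bound (fun k => (hVslice k s hs).aestronglyMeasurable)
        (fun k z => hVB k s hs z) (hpt s hs) (sub_pos.2 hst) x
    have hsub : Ioo s t ×ˢ (univ : Set E³) ⊆ Iio (0 : ℝ) ×ˢ univ :=
      prod_mono (fun τ hτ => hτ.2.trans ht) subset_rfl
    have hmeas : MeasurableSet (Ioo s t ×ˢ (univ : Set E³)) := measurableSet_Ioo.prod MeasurableSet.univ
    have h3 : Tendsto (fun k => oseenDuhamel 1 s (V k) (V k) t x) atTop (𝓝 (oseenDuhamel 1 s N N t x)) :=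
      tendsto_oseenDuhamel_of_tendsto_of_bound one_pos hB0 hst
        (fun k => ((hVcont k).mono hsub).aestronglyMeasurable hmeas)
        ((hNcont.mono hsub).aestronglyMeasurable hmeas)
        (fun k τ hτ y => hVB k τ (hτ.2.trans ht) y) (fun τ hτ y => hpt τ (hτ.2.trans ht) y) x
    have h4 : Tendsto (fun k => V k t x) atTop
        (𝓝 (UnboundedOperators.heatExtension (N s) (t - s) x - oseenDuhamel 1 s N N t x)) :=
      (h2.sub h3).congr fun k => (hVoseen k s t hst ht x).symm
    exact tendsto_nhds_unique h1 h4
  -- (iv) the bound and (v) the rate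
  have hNB : ∀ t < 0, ∀ x : E³, ‖N t x‖ ≤ B := fun t ht x =>
    le_of_tendsto' (hpt t ht x).norm fun k => hVB k t ht x
  have hNC : HasTypeITimeDecay C N := fun t ht x =>
    le_of_tendsto' (hpt t ht x).norm fun k => hVC k t ht x
  -- (vi) suitable data with `𝐈 < ⊤`: the engine on the transformed triples
  set qk : ℕ → ℝ → E³ → ℝ := fun k => lk k ^ 2 • stPull (lk k ^ 2) (lk k) (tk k) (xk k) q with hqk
  set Gk : ℕ → ℝ → E³ → E³ →L[ℝ] E³ := fun k => lk k ^ 2 • stPull (lk k ^ 2) (lk k) (tk k) (xk k) H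
    with hGk
  have hle : ∀ k, (slab E³ (Iio 0) isOpen_Iio) ≤
      stPreimage (lk k ^ 2) (lk k) (tk k) (xk k) (slab E³ (Iio 0) isOpen_Iio) := fun k =>
    slab_le_stPreimage_hull (hadm k).1 (hadm k).2.1 _
  have hswsk : ∀ k, IsSuitableWeakSolutionOn (slab E³ (Iio 0) isOpen_Iio) 1 0 (V k) (qk k) := fun k =>
    (zoom_isSuitableWeakSolutionOn hsws (hadm k).2.1 (tk k) (xk k)).of_le (hle k)
  have hgradk : ∀ k, HasWeakSpatialGradientOn (slab E³ (Iio 0) isOpen_Iio) (V k) (Gk k) := fun k =>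
    (zoom_hasWeakSpatialGradientOn hgrad (hadm k).2.1 (tk k) (xk k)).mono (hle k)
  set I := typeIBound (Iio (0 : ℝ) ×ˢ (univ : Set E³)) M q H with hIdef
  have hIk : ∀ k, typeIBound (Iio (0 : ℝ) ×ˢ univ) (V k) (qk k) (Gk k) ≤ I := fun k =>
    typeIBound_le_iff.2 fun r hr z hz =>
      abScaledSum_zoom_le_typeIBound (hadm k).2.1 (hadm k).1 (xk k) hr
        (fst_nonpos_of_parabolicCylinder_subset_slab hr hz)
  obtain ⟨u', p', H', σ, hσ, hsws', hgrad', hI', hconv', -⟩ := hE I V qk Gk hI hswsk hgradk hIk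
  -- identification `u' = N` a.e. on the slab, ball by ball
  have hball : ∀ n : ℕ, ∀ᵐ w ∂(volume.restrict (parabolicCylinder ((n : ℝ) + 1) (0 : ℝ × E³))),
      uncurry u' w = uncurry N w := by
    intro n
    set Q : Set (ℝ × E³) := parabolicCylinder ((n : ℝ) + 1) (0 : ℝ × E³) with hQ
    have hQslab : Q ⊆ Iio (0 : ℝ) ×ˢ (univ : Set E³) := parabolicCylinder_origin_subset_slab _
    have hQmeas : MeasurableSet Q := by
      rw [hQ]
      exact measurableSet_Ioo.prod measurableSet_ball
    have hvm : ∀ j, AEStronglyMeasurable (uncurry (V (σ j))) (volume.restrict Q) := fun j =>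
      ((hgradk (σ j)).locallyIntegrableOn.aestronglyMeasurable).mono_measure
        (Measure.restrict_mono hQslab le_rfl)
    have hum : AEStronglyMeasurable (uncurry u') (volume.restrict Q) :=
      (hgrad'.locallyIntegrableOn.aestronglyMeasurable).mono_measure
        (Measure.restrict_mono hQslab le_rfl)
    have hTIM : TendstoInMeasure (volume.restrict Q) (fun j => uncurry (V (σ j))) atTop (uncurry u') :=
      tendstoInMeasure_of_tendsto_eLpNorm (by norm_num) hvm hum (hconv' ((n : ℝ) + 1) (by positivity))
    obtain ⟨ns, hns, hae⟩ := hTIM.exists_seq_tendsto_ae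
    filter_upwards [hae, ae_restrict_mem hQmeas] with w hw hwQ
    have hw1 : w.1 < 0 := (hQslab hwQ).1
    have h2 : Tendsto (fun i => uncurry (V (σ (ns i))) w) atTop (𝓝 (uncurry N w)) :=
      (hpt w.1 hw1 w.2).comp (hσ.tendsto_atTop.comp hns.tendsto_atTop)
    exact tendsto_nhds_unique hw h2
  have hae : ∀ᵐ w ∂(volume.restrict (Iio (0 : ℝ) ×ˢ (univ : Set E³))), uncurry u' w = uncurry N w :=
    ae_restrict_of_ae_restrict_of_subset slab_subset_iUnion_parabolicCylinder
      ((ae_restrict_iUnion_iff _ _).2 hball)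
  have hae' : ∀ᵐ w ∂(volume.restrict ((slab E³ (Iio 0) isOpen_Iio : Opens (ℝ × E³)) : Set (ℝ × E³))),
      uncurry u' w = uncurry N w := by
    rw [coe_slab]
    exact hae
  refine ⟨hNcont, hNdiv, hNoseen, hNB, hNC, p', H', hsws'.congr_ae hae' (ae_of_all _ fun _ => rfl),
    hgrad'.congr_ae hae', ?_⟩
  rw [← typeIBound_congr_ae hae]
  exact lt_of_le_of_lt hI' (ENNReal.mul_lt_top (by simp) hI)

/-! ### Conformance: the full type of `stub_hullClosed`, verbatim, CLOSED by `inBridgeClass_hullLimit` -/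
example :
    (∀ (I : ℝ≥0∞) (v : ℕ → ℝ → E³ → E³) (q : ℕ → ℝ → E³ → ℝ) (G : ℕ → ℝ → E³ → E³ →L[ℝ] E³),
      I < ⊤ →
      (∀ k, IsSuitableWeakSolutionOn (slab E³ (Iio 0) isOpen_Iio) 1 0 (v k) (q k)) →
      (∀ k, HasWeakSpatialGradientOn (slab E³ (Iio 0) isOpen_Iio) (v k) (G k)) →
      (∀ k, typeIBound (Iio (0 : ℝ) ×ˢ univ) (v k) (q k) (G k) ≤ I) →
      ∃ (u : ℝ → E³ → E³) (p : ℝ → E³ → ℝ) (H : ℝ → E³ → E³ →L[ℝ] E³) (σ : ℕ → ℕ),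
        StrictMono σ ∧
        IsSuitableWeakSolutionOn (slab E³ (Iio 0) isOpen_Iio) 1 0 u p ∧
        HasWeakSpatialGradientOn (slab E³ (Iio 0) isOpen_Iio) u H ∧
        typeIBound (Iio (0 : ℝ) ×ˢ univ) u p H ≤ 4 * I ∧
        (∀ R : ℝ, 0 < R → Tendsto (fun j => eLpNorm (uncurry (v (σ j)) - uncurry u) 3
          (volume.restrict (parabolicCylinder R (0 : ℝ × E³)))) atTop (𝓝 0)) ∧
        ((∀ R : ℝ, 0 < R → limsup (fun j => eLpNorm (uncurry (v (σ j))) ⊤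
            (volume.restrict (parabolicCylinder R (0 : ℝ × E³)))) atTop = ⊤) →
          IsBackwardSingularPoint u 0)) →
    ∀ (C B : ℝ) (M : ℝ → E³ → E³) (xk : ℕ → E³) (tk : ℕ → ℝ) (lk : ℕ → ℝ) (N : ℝ → E³ → E³),
      (ContinuousOn (uncurry M) (Iio (0 : ℝ) ×ˢ univ) ∧
        (∀ t < 0, IsWeaklyDivFree (M t)) ∧
        (∀ s t : ℝ, s < t → t < 0 → ∀ x : E³,
          M t x = UnboundedOperators.heatExtension (M s) (t - s) x - oseenDuhamel 1 s M M t x) ∧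
        (∀ t < 0, ∀ x : E³, ‖M t x‖ ≤ B) ∧
        HasTypeITimeDecay C M ∧
        (∃ (q : ℝ → E³ → ℝ) (H : ℝ → E³ → E³ →L[ℝ] E³),
          IsSuitableWeakSolutionOn (slab E³ (Iio 0) isOpen_Iio) 1 0 M q ∧
          HasWeakSpatialGradientOn (slab E³ (Iio 0) isOpen_Iio) M H ∧
          typeIBound (Iio (0 : ℝ) ×ˢ univ) M q H < ⊤)) →
      (∀ k, tk k ≤ 0 ∧ 0 < lk k ∧ lk k ≤ 1) →
      (∀ t < 0, TendstoLocallyUniformly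
        (fun k (y : E³) => lk k • M (tk k + lk k ^ 2 * t) (xk k + lk k • y)) (N t) atTop) →
      ContinuousOn (uncurry N) (Iio (0 : ℝ) ×ˢ univ) →
      (ContinuousOn (uncurry N) (Iio (0 : ℝ) ×ˢ univ) ∧
        (∀ t < 0, IsWeaklyDivFree (N t)) ∧
        (∀ s t : ℝ, s < t → t < 0 → ∀ x : E³,
          N t x = UnboundedOperators.heatExtension (N s) (t - s) x - oseenDuhamel 1 s N N t x) ∧
        (∀ t < 0, ∀ x : E³, ‖N t x‖ ≤ B) ∧
        HasTypeITimeDecay C N ∧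
        (∃ (q : ℝ → E³ → ℝ) (H : ℝ → E³ → E³ →L[ℝ] E³),
          IsSuitableWeakSolutionOn (slab E³ (Iio 0) isOpen_Iio) 1 0 N q ∧
          HasWeakSpatialGradientOn (slab E³ (Iio 0) isOpen_Iio) N H ∧
          typeIBound (Iio (0 : ℝ) ×ˢ univ) N q H < ⊤)) :=
  fun hE _ _ _ _ _ _ _ hM hadm hconv hNcont => inBridgeClass_hullLimit hE hM hadm hconv hNcont

end Summit.NavierStokesRegularity.NavierStokesRegularity.Theorems.ApexLocalisation.Negative
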